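import Summits.AnomalousDissipation.AnomalousDissipation.Theses.MomentParity
import Literature.Analysis.FluidPDE.CylindricalGenerator
import Literature.Analysis.FluidPDE.StatisticalSolutionEnergyEq
import Literature.Analysis.FluidPDE.StatisticalSolutionDirac
import Literature.Analysis.FluidPDE.StatisticalSolutionProofs
import Literature.Analysis.FunctionSpaces.TorusFourierModes
import Literature.Analysis.FunctionSpaces.TorusVectorParseval

/-!
# An orthonormal band basis of the level-`N` Galerkin space (infrastructure I1 for
`MomentParity.QuarticGate`, line `recession-cone`, stmt-AnomalousDissipation-11464)

The level-`N` Galerkin space `V_N ⊂ H = L²_σ(T³)` (fields carried by `0 < |k|² ≤ N²`) is spanned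
by the Parseval frame `Torus.frameFieldIdx N` of `StatisticalSolutionEnergyEq`. Here we extract an
ORTHONORMAL basis `b : Fin n → (T³ → ℝ³)` of `V_N` made of smooth, divergence-free, mean-zero,
band-limited fields (`exists_bandBasis`), in the unfolded vocabulary of the crux (no definitions):

* `hb`  : every `b i` is a band test (smooth, div-free, mean-zero, `𝓕(b i)(k) = 0` off the band);
* `hbo` : `∫ ⟪b i, b j⟫ = δ_{ij}`;
* `hbs` : `P_N u = Σ_i (u, b i) b i` pointwise for `u ∈ H` (stated for level-`N` `u` to match the
  registered stub; the hypothesis is not used).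

Construction: `stdOrthonormalBasis` of the span of the frame classes in `L²`, each basis class
written back as a finite combination of frame fields; `hbs` from the frame reconstruction
`sum_integral_inner_frameField_smul` and continuity.
-/

namespace Summit.AnomalousDissipation.AnomalousDissipation.Theorems.MomentParityQuarticGate

open MeasureTheory Filter
open scoped InnerProductSpace RealInnerProductSpace ENNReal
open Literature.Analysis.FunctionSpaces Literature.Analysis.FluidPDE
open Summit.AnomalousDissipation.AnomalousDissipation.Theses.MomentParity

set_option linter.dupNamespace false

/-! ## Small analytic helpers -/

/-- Fourier coefficients of a real multiple: `𝓕(c v)(k) = c 𝓕(v)(k)`. [folklore] -/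
theorem mFourierCoeff_complexify_smul (c : ℝ) (v : UnitAddTorus (Fin 3) → EuclideanSpace ℝ (Fin 3))
    (k : Fin 3 → ℤ) :
    UnitAddTorus.mFourierCoeff (EuclideanSpace.complexify ∘ fun x => c • v x) k =
      (c : ℂ) • UnitAddTorus.mFourierCoeff (EuclideanSpace.complexify ∘ v) k := by
  rw [← Torus.mFourierCoeff_const_smul]
  congr 1
  funext x
  simp only [Function.comp_apply, map_smul, Pi.smul_apply, Complex.coe_smul]

/-- Fourier coefficients of a finite real combination of continuous fields. [folklore] -/
theorem mFourierCoeff_complexify_sum_smul {ι : Type*} (s : Finset ι) (c : ι → ℝ)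
    {e : ι → UnitAddTorus (Fin 3) → EuclideanSpace ℝ (Fin 3)} (he : ∀ a, Continuous (e a))
    (k : Fin 3 → ℤ) :
    UnitAddTorus.mFourierCoeff (EuclideanSpace.complexify ∘ fun x => ∑ a ∈ s, c a • e a x) k =
      ∑ a ∈ s, (c a : ℂ) • UnitAddTorus.mFourierCoeff (EuclideanSpace.complexify ∘ e a) k := by
  have h1 : (EuclideanSpace.complexify ∘ fun x => ∑ a ∈ s, c a • e a x) =
      fun x => ∑ a ∈ s, (EuclideanSpace.complexify ∘ fun y => c a • e a y) x := by
    funext x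
    simp only [Function.comp_apply, map_sum]
  have h2 : ∀ a ∈ s, Integrable (EuclideanSpace.complexify ∘ fun y => c a • e a y) volume :=
    fun a _ => Torus.integrable_complexify_comp
      (((he a).const_smul (c a)).integrable_unitAddTorus (f := fun y => c a • e a y))
  rw [h1, Torus.mFourierCoeff_finset_sum s
    (f := fun a => EuclideanSpace.complexify ∘ fun y => c a • e a y) h2]
  exact Finset.sum_congr rfl fun a _ => mFourierCoeff_complexify_smul (c a) (e a) k

/-- The a.e. value of a finite real combination of `Lp` classes. [folklore] -/
theorem coeFn_sum_smul {α E : Type*} {m : MeasurableSpace α} {μ : Measure α} {p : ℝ≥0∞}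
    [NormedAddCommGroup E] [NormedSpace ℝ E] {ι : Type*} (s : Finset ι) (c : ι → ℝ)
    (f : ι → Lp E p μ) :
    ((∑ a ∈ s, c a • f a : Lp E p μ) : α → E) =ᵐ[μ] fun x => ∑ a ∈ s, c a • (f a : α → E) x := by
  classical
  induction s using Finset.induction_on with
  | empty =>
    simp only [Finset.sum_empty]
    exact Lp.coeFn_zero E p μ
  | insert a s ha ih =>
    rw [Finset.sum_insert ha]
    filter_upwards [Lp.coeFn_add (c a • f a) (∑ b ∈ s, c b • f b), Lp.coeFn_smul (c a) (f a), ih]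
      with x h1 h2 h3
    rw [h1, Pi.add_apply, h2, Pi.smul_apply, h3, Finset.sum_insert ha]

/-- Two continuous fields on `T³` that agree a.e. agree everywhere (`volume` charges open sets).
[folklore] -/
theorem eq_of_ae_eq_of_continuous {v w : UnitAddTorus (Fin 3) → EuclideanSpace ℝ (Fin 3)}
    (hv : Continuous v) (hw : Continuous w) (h : v =ᵐ[volume] w) : v = w :=
  (Continuous.ae_eq_iff_eq volume hv hw).1 h

/-! ## Frame fields and their finite combinations are band tests -/

/-- Frame fields are band tests at their own level. [folklore] -/
-- adapted from Cruxes/QuarticGate/Disproof.lean (`isBandTest_frameG`)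
theorem frameFieldIdx_band (N : ℕ) (p : Torus.FrameIdx (Fin 3) N) :
    Torus.IsSmooth (Torus.frameFieldIdx N p) ∧ Torus.IsDivFree (Torus.frameFieldIdx N p) ∧
      Torus.HasZeroMean (Torus.frameFieldIdx N p) ∧
      ∀ k ∉ (Torus.freqBall N).erase (0 : Fin 3 → ℤ),
        UnitAddTorus.mFourierCoeff (EuclideanSpace.complexify ∘ Torus.frameFieldIdx N p) k = 0 := by
  have hk0 : (p.1 : Fin 3 → ℤ) ≠ 0 := Torus.ne_zero_of_mem_freqBall₀ _
  have hkN : (p.1 : Fin 3 → ℤ) ∈ Torus.freqBall N := Finset.mem_of_mem_erase p.1.2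
  refine ⟨Torus.isSmooth_realTrigPoly _ _, Torus.isDivFree_frameField hk0 _ _,
    Torus.integral_frameField hk0 _ _, fun k' hk' => ?_⟩
  change UnitAddTorus.mFourierCoeff (EuclideanSpace.complexify ∘
    Torus.realTrigPoly {(p.1 : Fin 3 → ℤ)}
      (fun _ => Torus.frameVec (p.1 : Fin 3 → ℤ) p.2.1 p.2.2)) k' = 0
  by_cases h0 : k' = 0
  · subst h0
    refine Torus.mFourierCoeff_realTrigPoly_eq_zero_of_not_mem _ ?_ ?_ <;>
      simpa [Finset.mem_singleton] using fun h => hk0 h.symm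
  · have hk'N : k' ∉ Torus.freqBall N := fun h => hk' (Finset.mem_erase.2 ⟨h0, h⟩)
    exact Torus.mFourierCoeff_realTrigPoly_singleton_eq_zero _ _
      ((Torus.mem_freqBall.1 hkN).trans_lt (Torus.not_mem_freqBall.1 hk'N))

/-- Finite real combinations of frame fields are band tests. [folklore] -/
theorem sum_smul_frameFieldIdx_band (N : ℕ) (c : Torus.FrameIdx (Fin 3) N → ℝ) :
    Torus.IsSmooth (fun x => ∑ a, c a • Torus.frameFieldIdx N a x) ∧
      Torus.IsDivFree (fun x => ∑ a, c a • Torus.frameFieldIdx N a x) ∧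
      Torus.HasZeroMean (fun x => ∑ a, c a • Torus.frameFieldIdx N a x) ∧
      ∀ k ∉ (Torus.freqBall N).erase (0 : Fin 3 → ℤ),
        UnitAddTorus.mFourierCoeff (EuclideanSpace.complexify ∘
          fun x => ∑ a, c a • Torus.frameFieldIdx N a x) k = 0 := by
  have hB := frameFieldIdx_band N
  refine ⟨Torus.IsSmooth.sum_smul Finset.univ c fun a => (hB a).1,
    Torus.IsDivFree.sum_smul Finset.univ c (fun a => (hB a).1) fun a => (hB a).2.1,
    Torus.HasZeroMean.sum_smul Finset.univ c (fun a => (hB a).1.integrable) fun a => (hB a).2.2.1,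
    fun k hk => ?_⟩
  rw [mFourierCoeff_complexify_sum_smul Finset.univ c (fun a => (hB a).1.continuous) k]
  exact Finset.sum_eq_zero fun a _ => by rw [(hB a).2.2.2 k hk, smul_zero]

/-- The frame reconstructs the truncation, indexed by `FrameIdx`:
`P_N u (x) = Σ_a (u, e_a) e_a (x)`. [folklore] -/
theorem fourierTruncate_eq_sum_frameFieldIdx (N : ℕ) (u : Torus.energySpace (Fin 3))
    (x : UnitAddTorus (Fin 3)) :
    Torus.fourierTruncate N (u.1 : UnitAddTorus (Fin 3) → EuclideanSpace ℝ (Fin 3)) x =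
      ∑ a : Torus.FrameIdx (Fin 3) N,
        Torus.pairing u.1 (Torus.frameFieldIdx N a) • Torus.frameFieldIdx N a x := by
  rw [Fintype.sum_prod_type, ← Torus.sum_integral_inner_frameField_smul u.2 N x,
    ← Finset.sum_coe_sort (Torus.freqBall₀ N)]
  refine Finset.sum_congr rfl fun k _ => ?_
  rw [Fintype.sum_prod_type]
  rfl

/-! ## The orthonormal band basis -/

/-- **I1 — orthonormal band basis of `V_N`.** There are `n` and fields `b : Fin n → (T³ → ℝ³)`
such that every `b i` is a band test at level `N` (smooth, divergence free, mean zero, Fourier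
support in `0 < |k|² ≤ N²`), the family is `L²`-orthonormal, and the truncation of every (level-`N`)
`u ∈ H` is `P_N u = Σ_i (u, b i) b i` pointwise. In the last clause the level-`N` hypothesis on `u` is
kept to match the registered stub; it is not needed (`(P_N u, b i) = (u, b i)` for every `u ∈ L²`,
`Torus.integral_inner_fourierTruncate_eq`). [folklore] -/
theorem exists_bandBasis :
    ∀ N : ℕ, ∃ (n : ℕ) (b : Fin n → UnitAddTorus (Fin 3) → EuclideanSpace ℝ (Fin 3)),
      (∀ i, Torus.IsSmooth (b i) ∧ Torus.IsDivFree (b i) ∧ Torus.HasZeroMean (b i) ∧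
        ∀ k ∉ (Torus.freqBall N).erase (0 : Fin 3 → ℤ),
          UnitAddTorus.mFourierCoeff (EuclideanSpace.complexify ∘ (b i)) k = 0) ∧
      (∀ i j, ∫ x, ⟪b i x, b j x⟫_ℝ = if i = j then (1 : ℝ) else 0) ∧
      (∀ u : Torus.energySpace (Fin 3),
        (∀ k ∉ (Torus.freqBall N).erase (0 : Fin 3 → ℤ),
          UnitAddTorus.mFourierCoeff (EuclideanSpace.complexify ∘
            (u.1 : UnitAddTorus (Fin 3) → EuclideanSpace ℝ (Fin 3))) k = 0) →
        ∀ x, Torus.fourierTruncate N (u.1 : UnitAddTorus (Fin 3) → EuclideanSpace ℝ (Fin 3)) x =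
          ∑ i, Torus.pairing u.1 (b i) • b i x) := by
  intro N
  classical
  have hB := frameFieldIdx_band N
  have he : ∀ a : Torus.FrameIdx (Fin 3) N, MemLp (Torus.frameFieldIdx N a) 2 volume :=
    fun a => (hB a).1.memLp 2
  -- the frame classes `E a ∈ L²` and their span `V`
  set E : Torus.FrameIdx (Fin 3) N →
      Lp (EuclideanSpace ℝ (Fin 3)) 2 (volume : Measure (UnitAddTorus (Fin 3))) :=
    fun a => (he a).toLp (Torus.frameFieldIdx N a) with hE
  have hEae : ∀ a, (E a : UnitAddTorus (Fin 3) → EuclideanSpace ℝ (Fin 3)) =ᵐ[volume]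
      Torus.frameFieldIdx N a := fun a => (he a).coeFn_toLp
  clear_value E
  have hEall : ∀ᵐ y ∂volume, ∀ a, (E a : UnitAddTorus (Fin 3) → EuclideanSpace ℝ (Fin 3)) y =
      Torus.frameFieldIdx N a y := eventually_all.2 hEae
  set V : Submodule ℝ (Lp (EuclideanSpace ℝ (Fin 3)) 2 (volume : Measure (UnitAddTorus (Fin 3)))) :=
    Submodule.span ℝ (Set.range E) with hV
  haveI : FiniteDimensional ℝ V := FiniteDimensional.span_of_finite ℝ (Set.finite_range E)
  obtain ⟨W⟩ : Nonempty (OrthonormalBasis (Fin (Module.finrank ℝ V)) ℝ V) :=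
    ⟨stdOrthonormalBasis ℝ V⟩
  have hc : ∀ i, ∃ c : Torus.FrameIdx (Fin 3) N → ℝ, ∑ a, c a • E a = (W i).1 := fun i =>
    (Submodule.mem_span_range_iff_exists_fun ℝ).1 (W i).2
  choose c hc using hc
  set b : Fin (Module.finrank ℝ V) → UnitAddTorus (Fin 3) → EuclideanSpace ℝ (Fin 3) :=
    fun i x => ∑ a, c i a • Torus.frameFieldIdx N a x with hb_def
  -- the basis functions represent the classes `W i`, and are band tests
  have hae : ∀ i, ((W i).1 : UnitAddTorus (Fin 3) → EuclideanSpace ℝ (Fin 3)) =ᵐ[volume] b i := by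
    intro i
    rw [← hc i]
    filter_upwards [coeFn_sum_smul Finset.univ (c i) E, hEall] with y hy hy'
    rw [hy]
    exact Finset.sum_congr rfl fun a _ => by rw [hy' a]
  have hband : ∀ i, Torus.IsSmooth (b i) ∧ Torus.IsDivFree (b i) ∧ Torus.HasZeroMean (b i) ∧
      ∀ k ∉ (Torus.freqBall N).erase (0 : Fin 3 → ℤ),
        UnitAddTorus.mFourierCoeff (EuclideanSpace.complexify ∘ (b i)) k = 0 :=
    fun i => sum_smul_frameFieldIdx_band N (c i)
  clear_value b
  have hall : ∀ᵐ y ∂volume, ∀ i, ((W i).1 : UnitAddTorus (Fin 3) → EuclideanSpace ℝ (Fin 3)) y =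
      b i y := eventually_all.2 hae
  refine ⟨Module.finrank ℝ V, b, hband, fun i j => ?_, fun u _ x => ?_⟩
  · -- orthonormality
    calc ∫ y, ⟪b i y, b j y⟫_ℝ
          = ∫ y, ⟪((W i).1 : UnitAddTorus (Fin 3) → EuclideanSpace ℝ (Fin 3)) y,
              ((W j).1 : UnitAddTorus (Fin 3) → EuclideanSpace ℝ (Fin 3)) y⟫_ℝ := by
          refine integral_congr_ae ?_
          filter_upwards [hae i, hae j] with y hy hy'
          rw [hy, hy']
      _ = ⟪(W i).1, (W j).1⟫_ℝ := (L2.inner_def _ _).symm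
      _ = ⟪W i, W j⟫_ℝ := (Submodule.coe_inner _ _ _).symm
      _ = if i = j then (1 : ℝ) else 0 := orthonormal_iff_ite.1 W.orthonormal i j
  · -- reconstruction of the truncation
    have hFsum := fourierTruncate_eq_sum_frameFieldIdx N u
    set F : UnitAddTorus (Fin 3) → EuclideanSpace ℝ (Fin 3) :=
      Torus.fourierTruncate N (u.1 : UnitAddTorus (Fin 3) → EuclideanSpace ℝ (Fin 3)) with hF
    have hFcont : Continuous F := by rw [hF]; exact Torus.continuous_fourierTruncate N _
    have hFmem : MemLp F 2 volume := by rw [hF]; exact Torus.memLp_fourierTruncate N _ 2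
    -- `(F, b i) = (u, b i)` (the `b i` are band limited)
    have hFpair : ∀ i, ∫ y, ⟪F y, b i y⟫_ℝ = Torus.pairing u.1 (b i) := by
      intro i
      have hbiband : ∀ k ∉ Torus.freqBall N,
          UnitAddTorus.mFourierCoeff (EuclideanSpace.complexify ∘ b i) k = 0 :=
        fun k hk => (hband i).2.2.2 k fun h => hk (Finset.mem_of_mem_erase h)
      rw [hF]
      exact Torus.integral_inner_fourierTruncate_eq (Lp.memLp u.1) ((hband i).1.memLp 2) hbiband
    clear_value F
    have hFeq : hFmem.toLp F = ∑ a, Torus.pairing u.1 (Torus.frameFieldIdx N a) • E a := by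
      refine Lp.ext ?_
      filter_upwards [hFmem.coeFn_toLp,
        coeFn_sum_smul Finset.univ (fun a => Torus.pairing u.1 (Torus.frameFieldIdx N a)) E, hEall]
        with y hy hy' hy''
      rw [hy, hy', hFsum y]
      exact Finset.sum_congr rfl fun a _ => by rw [hy'' a]
    have hFV : hFmem.toLp F ∈ V := by
      rw [hFeq]
      exact Submodule.sum_mem _ fun a _ => Submodule.smul_mem _ _ (Submodule.subset_span ⟨a, rfl⟩)
    -- expand the class of `F` in the orthonormal basis
    have hcoe : (∑ i, ⟪(W i).1, hFmem.toLp F⟫_ℝ • (W i).1) = hFmem.toLp F := by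
      have h := congrArg Subtype.val (W.sum_repr' ⟨hFmem.toLp F, hFV⟩)
      rw [Submodule.coe_sum] at h
      simpa only [Submodule.coe_smul, Submodule.coe_inner] using h
    -- the coefficients are the pairings `(u, b i)`
    have hcoef : ∀ i, ⟪(W i).1, hFmem.toLp F⟫_ℝ = Torus.pairing u.1 (b i) := by
      intro i
      rw [← hFpair i, L2.inner_def]
      refine integral_congr_ae ?_
      filter_upwards [hae i, hFmem.coeFn_toLp] with y hy hy'
      rw [hy, hy', real_inner_comm]
    have h2 : (hFmem.toLp F : UnitAddTorus (Fin 3) → EuclideanSpace ℝ (Fin 3)) =ᵐ[volume]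
        fun y => ∑ i, ⟪(W i).1, hFmem.toLp F⟫_ℝ •
          ((W i).1 : UnitAddTorus (Fin 3) → EuclideanSpace ℝ (Fin 3)) y := by
      have h := coeFn_sum_smul Finset.univ (fun i => ⟪(W i).1, hFmem.toLp F⟫_ℝ) fun i => (W i).1
      rwa [hcoe] at h
    have h4 : F =ᵐ[volume] fun y => ∑ i, Torus.pairing u.1 (b i) • b i y := by
      filter_upwards [hFmem.coeFn_toLp, h2, hall] with y hy hy2 hy3
      rw [← hy, hy2]
      exact Finset.sum_congr rfl fun i _ => by rw [hcoef i, hy3 i]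
    have hcont : Continuous fun y => ∑ i, Torus.pairing u.1 (b i) • b i y :=
      continuous_finsetSum _ fun i _ =>
        (continuous_const (y := Torus.pairing u.1 (b i))).smul (hband i).1.continuous
    exact congrFun (eq_of_ae_eq_of_continuous hFcont hcont h4) x

end Summit.AnomalousDissipation.AnomalousDissipation.Theorems.MomentParityQuarticGate
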